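import Mathlib
import Summits.ResolutionOfSingularities.ResolutionOfSingularities.Theorems.FrobeniusClosingSteerRadicandChainRealisationBase
import HarnessLib

/-!
# Crux `Steer` (stmt-ResolutionOfSingularities-16345), chain W4.1, R2 σ_top line: **K(2) realisation layer,
# the tower** — all radicand rings of a radicand chain inside ONE field

OURS (campaign `res-hironaka`, rung L ★L-G4, slot W4.1; seat `res-L1-type-o8` = `res-D-pv-015`; SPLIT of
res-L0-w41-plan-1's ORDER 05:10:18Z, realisation half, agreed with the K(2) holder res-type-026 05:29:44Z).  Not a
statement of the manuscript under review; AI review is weaker than expert review.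

Data of a radicand chain (the binders of idea-1's `NoEternalIsolatedRadicandChain p c`, `L/w41/Sketch-R2-steered.lean`
§3.1): local subrings `S m ⊆ L` of a field of characteristic `p`, radicands `f m ∈ S m`, `g m ∈ S m`, `x m ∈ S (m+1)`
with `f (m+1) · (x m)^p = f m − (g m)^p`.  This file builds:

* `baseField S` — the subfield `L₀ ⊆ L` generated by all members (with the chain hypotheses it is the common field
  of fractions of every `S m`; NOT `L`, which may be perfect); `toBase`, `emb` — the embeddings `S m → L₀ → K′`;
* `radPoly p S f = X ^ p − C (f 0)` over `L₀` and the field `K′ := AdjoinRoot (radPoly p S f)` (a field as soon as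
  `f 0` has no `p`-th root in `L₀` — supplied by isolatedness, `RadicandChainRealisationBase`);
* `theta` — the tower `θ 0 = root`, `θ (m+1) = (θ m − g m) / x m` in `K′`, with `(θ m)^p = f m` (`theta_pow`);
* `phi hθ m : AdjoinRoot (X^p − C (f m)) →+* K′`, `X ↦ θ m`, INJECTIVE when `f m` has no `p`-th root among the
  fractions of `S m` (`phi_injective`), its range `realR hθ m ⊆ K′` and `realR hθ m ≤ realR hθ (m+1)`;
* the layer-1 conclusions (locality, fractions, excellence, dimension) are in `…RealisationLayerOne`.
[folklore]
-/

noncomputable section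

-- `Summit.<S>.<S>.…` duplicates the summit name by design (single-problem summit).
set_option linter.dupNamespace false

open Polynomial IsLocalRing

namespace Summit.ResolutionOfSingularities.ResolutionOfSingularities.Theorems.SwitchingDichotomy

namespace RadicandChainRealisation

open Literature.AlgebraicGeometry.Resolution

universe u

/-! ## (0) Two generic lemmas: range of `AdjoinRoot.lift`, injectivity of `AdjoinRoot.lift` into a field -/

section Generic

variable {A K : Type*} [CommRing A] [Field K]

/-- The range of `AdjoinRoot.lift i a h` lies in any subring containing `i(A)` and `a`. [folklore] -/
theorem lift_range_le {q : A[X]} {i : A →+* K} {a : K} (h : q.eval₂ i a = 0) (T : Subring K)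
    (hi : ∀ s, i s ∈ T) (ha : a ∈ T) : (AdjoinRoot.lift i a h).range ≤ T := by
  rintro z ⟨t, rfl⟩
  obtain ⟨P, rfl⟩ := AdjoinRoot.mk_surjective t
  rw [AdjoinRoot.lift_mk, eval₂_eq_sum]
  exact Subring.sum_mem _ fun n _ => T.mul_mem (hi _) (T.pow_mem ha n)

variable {p : ℕ} [hp : Fact p.Prime]

/-- **Injectivity of `A[θ]/(θ^p − f) → K`**: if `i : A → K` is an injective ring map into a field, `a ^ p = i f`,
and `i f` is not a `p`-th power of a fraction `i u / i v`, then `X ↦ a` embeds the radicand ring of `f` into `K`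
(the polynomial `X ^ p − i f` is irreducible over the subfield generated by `i(A)`, hence is the minimal polynomial
of `a`, so no non-zero polynomial of degree `< p` over `A` vanishes at `a`). [folklore] -/
theorem lift_injective_of_forall_pow_ne (i : A →+* K) (hi : Function.Injective i) (f : A) (a : K)
    (ha : a ^ p = i f) (hnr : ∀ u v : A, i v ≠ 0 → (i u / i v) ^ p ≠ i f)
    (h : ((X : A[X]) ^ p - C f).eval₂ i a = 0) :
    Function.Injective (AdjoinRoot.lift i a h) := by
  -- the subfield `F` generated by `i(A)` and the radicand polynomial over it
  set F : Subfield K := Subfield.closure (Set.range i) with hF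
  have hif : i f ∈ F := Subfield.subset_closure ⟨f, rfl⟩
  have hirr : Irreducible ((X : F[X]) ^ p - C (⟨i f, hif⟩ : F)) := by
    refine X_pow_sub_C_irreducible_of_prime hp.out fun b hb => ?_
    obtain ⟨y, hy, z, hz, hyz⟩ := (Subfield.mem_closure_iff).mp b.2
    rw [← RingHom.coe_range, Subring.closure_eq] at hy hz
    obtain ⟨u, rfl⟩ := RingHom.mem_range.mp hy
    obtain ⟨v, rfl⟩ := RingHom.mem_range.mp hz
    have hb' : ((b : K)) ^ p = i f := by
      have := congrArg (fun c : F => (c : K)) hb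
      simpa using this
    by_cases hv : i v = 0
    · apply hnr 0 1 (by rw [map_one]; exact one_ne_zero)
      rw [map_zero, zero_div, zero_pow hp.out.ne_zero]
      rw [← hb', ← hyz, hv, div_zero, zero_pow hp.out.ne_zero]
    · exact hnr u v hv (by rw [hyz]; exact hb')
  -- `a` is a root of it, so it is the minimal polynomial of `a` over `F`
  have hmonic : ((X : F[X]) ^ p - C (⟨i f, hif⟩ : F)).Monic := monic_X_pow_sub_C _ hp.out.ne_zero
  have haeval : Polynomial.aeval a ((X : F[X]) ^ p - C (⟨i f, hif⟩ : F)) = 0 := by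
    rw [map_sub, map_pow, aeval_X, aeval_C, ha, sub_eq_zero]; rfl
  have hmin : (X : F[X]) ^ p - C (⟨i f, hif⟩ : F) = minpoly F a :=
    minpoly.eq_of_irreducible_of_monic hirr haeval hmonic
  have hdeg : (minpoly F a).degree = p := by
    rw [← hmin, degree_X_pow_sub_C hp.out.pos]
  -- injectivity: reduce a polynomial in the kernel modulo the monic radicand polynomial
  haveI : Nontrivial A := i.domain_nontrivial
  rw [injective_iff_map_eq_zero]
  intro z hz
  obtain ⟨P, rfl⟩ := AdjoinRoot.mk_surjective z
  have hqmonic : ((X : A[X]) ^ p - C f).Monic := monic_X_pow_sub_C _ hp.out.ne_zero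
  set r := P %ₘ ((X : A[X]) ^ p - C f) with hr
  have hPr : AdjoinRoot.mk ((X : A[X]) ^ p - C f) P = AdjoinRoot.mk ((X : A[X]) ^ p - C f) r := by
    rw [AdjoinRoot.mk_eq_mk]
    refine ⟨P /ₘ ((X : A[X]) ^ p - C f), ?_⟩
    have := modByMonic_add_div P ((X : A[X]) ^ p - C f)
    rw [hr]
    linear_combination -this
  rw [hPr] at hz ⊢
  rw [AdjoinRoot.lift_mk] at hz
  -- the reduced polynomial, pushed into `F[X]`, vanishes at `a` and has degree `< p`: it is zero
  let i' : A →+* F := i.codRestrict F fun s => Subfield.subset_closure ⟨s, rfl⟩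
  have hi' : Function.Injective i' := by
    intro s t hst
    apply hi
    have := congrArg (fun c : F => (c : K)) hst
    simpa [i'] using this
  have hcomp : (F.subtype : F →+* K).comp i' = i := by ext s; rfl
  have haeval_r : Polynomial.aeval a (r.map i') = 0 := by
    rw [Polynomial.aeval_def, eval₂_map]
    change eval₂ ((F.subtype : F →+* K).comp i') a r = 0
    rw [hcomp]; exact hz
  have hr0 : r.map i' = 0 := by
    by_contra hne
    have h1 := minpoly.degree_le_of_ne_zero F a hne haeval_r
    rw [hdeg, degree_map_eq_of_injective hi'] at h1
    have h2 : r.degree < p := by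
      have := degree_modByMonic_lt P hqmonic
      rwa [degree_X_pow_sub_C hp.out.pos] at this
    exact absurd (lt_of_lt_of_le h2 h1) (lt_irrefl _)
  have : r = 0 := (Polynomial.map_eq_zero_iff hi').mp hr0
  rw [this, map_zero]

end Generic

/-! ## (1) The base field `L₀` and the embeddings -/

section Tower

variable (p : ℕ) {L : Type u} [Field L] (S : ℕ → Subring L)

/-- The base field `L₀ ⊆ L`: the subfield generated by all members `S m` of the chain.  OURS. [folklore] -/
def baseField : Subfield L := Subfield.closure (⋃ m, (S m : Set L))

variable {S} in
/-- Members lie in the base field. [folklore] -/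
theorem coe_mem_baseField {m : ℕ} (s : S m) : (s : L) ∈ baseField S :=
  Subfield.subset_closure (Set.mem_iUnion.mpr ⟨m, s.2⟩)

/-- The base field has characteristic `p`. [folklore] -/
theorem charP_baseField [CharP L p] : CharP (baseField S) p :=
  (baseField S).subtype.charP Subtype.coe_injective p

/-- The embedding `S m → L₀`.  OURS. [folklore] -/
def toBase (m : ℕ) : S m →+* baseField S :=
  (S m).subtype.codRestrict (baseField S) fun s => coe_mem_baseField s

/-- `toBase` is the identity on underlying elements of `L`. [folklore] -/
@[simp] theorem coe_toBase (m : ℕ) (s : S m) : ((toBase S m s : baseField S) : L) = s := rfl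

/-- `toBase` is injective. [folklore] -/
theorem toBase_injective (m : ℕ) : Function.Injective (toBase S m) := by
  intro s t hst
  have := congrArg (fun c : baseField S => (c : L)) hst
  exact Subtype.ext (by simpa using this)

variable (f : ∀ m, S m)

/-- The radicand polynomial `X ^ p − f 0` over the base field `L₀`.  OURS. [folklore] -/
abbrev radPoly : (baseField S)[X] := (X : (baseField S)[X]) ^ p - C (toBase S 0 (f 0))

/-- The embedding `S m → L₀ → K′ = L₀[X]/(X^p − f 0)`.  OURS. [folklore] -/
def emb (m : ℕ) : S m →+* AdjoinRoot (radPoly p S f) :=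
  (AdjoinRoot.of (radPoly p S f)).comp (toBase S m)

/-- `emb` factors through `AdjoinRoot.of`. [folklore] -/
theorem emb_apply (m : ℕ) (s : S m) : emb p S f m s = AdjoinRoot.of (radPoly p S f) (toBase S m s) := rfl

/-- `emb` only depends on the underlying element of `L`. [folklore] -/
theorem emb_eq_of_coe_eq {m n : ℕ} {s : S m} {t : S n} (h : (s : L) = t) :
    emb p S f m s = emb p S f n t := by
  rw [emb_apply, emb_apply]
  congr 1
  exact Subtype.ext h

variable [Fact (Irreducible (radPoly p S f))]

/-- `AdjoinRoot.of : L₀ → K′` is injective (once `K′` is a field). [folklore] -/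
theorem of_radPoly_injective : Function.Injective (AdjoinRoot.of (radPoly p S f)) :=
  (AdjoinRoot.of (radPoly p S f)).injective

/-- `emb` is injective. [folklore] -/
theorem emb_injective (m : ℕ) : Function.Injective (emb p S f m) :=
  (of_radPoly_injective p S f).comp (toBase_injective S m)

/-- `K′` has characteristic `p`. [folklore] -/
theorem charP_adjoinRoot_radPoly [CharP L p] : CharP (AdjoinRoot (radPoly p S f)) p :=
  haveI := charP_baseField p S
  charP_of_injective_algebraMap (R := baseField S)
    (by rw [AdjoinRoot.algebraMap_eq]; exact of_radPoly_injective p S f) p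

variable (g : ∀ m, S m) (x : ∀ m, S (m + 1))

/-- The tower of radicals in `K′`: `θ 0 = root`, `θ (m+1) = (θ m − g m) / x m`.  OURS. [folklore] -/
def theta : ℕ → AdjoinRoot (radPoly p S f)
  | 0 => AdjoinRoot.root (radPoly p S f)
  | m + 1 => (theta m - emb p S f m (g m)) / emb p S f (m + 1) (x m)

/-- `θ 0 = root`. [folklore] -/
@[simp] theorem theta_zero : theta p S f g x 0 = AdjoinRoot.root (radPoly p S f) := rfl

/-- `θ (m+1) = (θ m − g m) / x m`. [folklore] -/
theorem theta_succ (m : ℕ) :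
    theta p S f g x (m + 1) = (theta p S f g x m - emb p S f m (g m)) / emb p S f (m + 1) (x m) := rfl

/-- The transform law gives `θ m = x m · θ (m+1) + g m`. [folklore] -/
theorem theta_eq_succ (hx0 : ∀ m, (x m : L) ≠ 0) (m : ℕ) :
    theta p S f g x m = emb p S f (m + 1) (x m) * theta p S f g x (m + 1) + emb p S f m (g m) := by
  have hxm : emb p S f (m + 1) (x m) ≠ 0 := by
    intro h0
    apply hx0 m
    have := emb_injective p S f (m + 1) (h0.trans (map_zero _).symm)
    simp [this]
  rw [theta_succ, mul_div_cancel₀ _ hxm, sub_add_cancel]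

/-- **`(θ m) ^ p = f m`** along the tower, from the transform law `f (m+1) · (x m)^p = f m − (g m)^p`. [folklore] -/
theorem theta_pow [hp : Fact p.Prime] [CharP L p] (hx0 : ∀ m, (x m : L) ≠ 0)
    (hrel : ∀ m, ((f (m + 1) : S (m + 1)) : L) * ((x m : S (m + 1)) : L) ^ p =
      ((f m : S m) : L) - ((g m : S m) : L) ^ p) :
    ∀ m, theta p S f g x m ^ p = emb p S f m (f m) := by
  haveI := charP_adjoinRoot_radPoly p S f
  intro m
  induction m with
  | zero =>
    rw [theta_zero, emb_apply]
    exact root_pow_eq (S := baseField S) (p := p) (toBase S 0 (f 0))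
  | succ m ih =>
    have hxm : emb p S f (m + 1) (x m) ≠ 0 := by
      intro h0
      apply hx0 m
      have := emb_injective p S f (m + 1) (h0.trans (map_zero _).symm)
      simp [this]
    rw [theta_succ, div_pow, sub_pow_char, ih, div_eq_iff (pow_ne_zero _ hxm)]
    -- the relation in `L₀`, pushed into `K′`
    have key : toBase S m (f m - g m ^ p) = toBase S (m + 1) (f (m + 1) * x m ^ p) := by
      apply Subtype.ext
      simp only [coe_toBase]
      push_cast
      exact (hrel m).symm
    simp only [emb_apply, ← map_pow, ← map_sub, ← map_mul, key]

/-! ## (2) The embeddings `φ m : S m[θ]/(θ^p − f m) → K′`, `X ↦ θ m`, and their ranges `R m` -/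

/-- `θ m` is a root of the radicand polynomial of `f m` pushed into `K′`. [folklore] -/
theorem eval₂_radicand_theta (hθ : ∀ m, theta p S f g x m ^ p = emb p S f m (f m)) (m : ℕ) :
    ((X : (S m)[X]) ^ p - C (f m)).eval₂ (emb p S f m) (theta p S f g x m) = 0 := by
  rw [eval₂_sub, eval₂_X_pow, eval₂_C, hθ m, sub_self]

/-- The realisation map `φ m : S m[θ]/(θ^p − f m) → K′`, `θ ↦ θ m`.  OURS. [folklore] -/
def phi (hθ : ∀ m, theta p S f g x m ^ p = emb p S f m (f m)) (m : ℕ) :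
    AdjoinRoot ((X : (S m)[X]) ^ p - C (f m)) →+* AdjoinRoot (radPoly p S f) :=
  AdjoinRoot.lift (emb p S f m) (theta p S f g x m) (eval₂_radicand_theta p S f g x hθ m)

variable (hθ : ∀ m, theta p S f g x m ^ p = emb p S f m (f m))

/-- `φ m` on classes of polynomials. [folklore] -/
@[simp] theorem phi_mk (m : ℕ) (P : (S m)[X]) :
    phi p S f g x hθ m (AdjoinRoot.mk _ P) = P.eval₂ (emb p S f m) (theta p S f g x m) :=
  AdjoinRoot.lift_mk _ _

/-- `φ m (θ) = θ m`. [folklore] -/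
@[simp] theorem phi_root (m : ℕ) : phi p S f g x hθ m (AdjoinRoot.root _) = theta p S f g x m :=
  AdjoinRoot.lift_root _

/-- `φ m` restricted to `S m` is `emb`. [folklore] -/
@[simp] theorem phi_of (m : ℕ) (s : S m) : phi p S f g x hθ m (AdjoinRoot.of _ s) = emb p S f m s :=
  AdjoinRoot.lift_of _

/-- **`φ m` is injective** as soon as `f m` is not a `p`-th power of a fraction of `S m` (isolatedness,
`pow_ne_of_isolated`). [folklore] -/
theorem phi_injective [hp : Fact p.Prime] (m : ℕ) (hnr : ∀ u v : S m, v ≠ 0 → ((u : L) / (v : L)) ^ p ≠ (f m : L)) :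
    Function.Injective (phi p S f g x hθ m) := by
  refine lift_injective_of_forall_pow_ne (emb p S f m) (emb_injective p S f m) (f m) (theta p S f g x m) (hθ m)
    (fun u v hv h => ?_) _
  have hv0 : v ≠ 0 := fun hv0 => hv (by rw [hv0, map_zero])
  apply hnr u v hv0
  have h1 : (toBase S m u / toBase S m v) ^ p = toBase S m (f m) := by
    apply of_radPoly_injective p S f
    simpa [emb_apply, map_pow, map_div₀] using h
  have h2 := congrArg (fun c : baseField S => (c : L)) h1
  push_cast at h2
  simpa using h2

/-- The realised member `R m := φ m (S m[θ]/(θ^p − f m)) ⊆ K′`.  OURS. [folklore] -/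
def realR (m : ℕ) : Subring (AdjoinRoot (radPoly p S f)) := (phi p S f g x hθ m).range

/-- `θ m ∈ R m`. [folklore] -/
theorem theta_mem_realR (m : ℕ) : theta p S f g x m ∈ realR p S f g x hθ m :=
  ⟨AdjoinRoot.root _, phi_root p S f g x hθ m⟩

/-- `S m ⊆ R m` (through `emb`). [folklore] -/
theorem emb_mem_realR (m : ℕ) (s : S m) : emb p S f m s ∈ realR p S f g x hθ m :=
  ⟨AdjoinRoot.of _ s, phi_of p S f g x hθ m s⟩

/-- `S n ⊆ R m` whenever `S n ≤ S m`. [folklore] -/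
theorem emb_mem_realR_of_le {n m : ℕ} (h : S n ≤ S m) (s : S n) : emb p S f n s ∈ realR p S f g x hθ m := by
  rw [emb_eq_of_coe_eq p S f (s := s) (t := ⟨(s : L), h s.2⟩) rfl]
  exact emb_mem_realR p S f g x hθ m _

/-- The realisation equivalence `S m[θ]/(θ^p − f m) ≃+* R m` (when `φ m` is injective).  OURS. [folklore] -/
def equivRealR (m : ℕ) (hinj : Function.Injective (phi p S f g x hθ m)) :
    AdjoinRoot ((X : (S m)[X]) ^ p - C (f m)) ≃+* realR p S f g x hθ m :=
  RingEquiv.ofBijective (phi p S f g x hθ m).rangeRestrict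
    ⟨fun _ _ hab => hinj (congrArg Subtype.val hab), (phi p S f g x hθ m).rangeRestrict_surjective⟩

/-- Underlying element of the realisation equivalence. [folklore] -/
@[simp] theorem coe_equivRealR (m : ℕ) (hinj : Function.Injective (phi p S f g x hθ m))
    (t : AdjoinRoot ((X : (S m)[X]) ^ p - C (f m))) :
    ((equivRealR p S f g x hθ m hinj t : realR p S f g x hθ m) : AdjoinRoot (radPoly p S f)) =
      phi p S f g x hθ m t := rfl

/-- **`R m ≤ R (m+1)`**: `θ m = x m · θ (m+1) + g m` and `S m ≤ S (m+1)`. [folklore] -/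
theorem realR_le_succ (hle : ∀ m, S m ≤ S (m + 1)) (hx0 : ∀ m, (x m : L) ≠ 0) (m : ℕ) :
    realR p S f g x hθ m ≤ realR p S f g x hθ (m + 1) := by
  refine lift_range_le _ _ (fun s => emb_mem_realR_of_le p S f g x hθ (hle m) s) ?_
  rw [theta_eq_succ p S f g x hx0 m]
  exact Subring.add_mem _ (Subring.mul_mem _ (emb_mem_realR p S f g x hθ (m + 1) _)
    (theta_mem_realR p S f g x hθ (m + 1))) (emb_mem_realR_of_le p S f g x hθ (hle m) _)

end Tower

end RadicandChainRealisation

end Summit.ResolutionOfSingularities.ResolutionOfSingularities.Theorems.SwitchingDichotomy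

end
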